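/-
Copyright (c) 2026. All rights reserved.
Released under Apache 2.0 license as described in the file LICENSE.
-/
import Literature.NumberTheory.Automorphic.QuaternionRamificationParity
import Literature.NumberTheory.QuadraticForms.HilbertReciprocityRat
import Literature.NumberTheory.Automorphic.BrandtModuleDictionary
import HarnessLib

/-!
# `(−2,−5)_ℚ` is ramified exactly at `5` and `∞`: `Ram_f (−2,−5)_ℚ = {5}` in the `IsSplitAt` language (the format of the
# Brandt setups `Brandt.XiSetup 1 5`), and `(−2,−5)_ℚ` is totally definite — the definite quaternion algebra of discriminant `5`

[tag: quaternion_algebra] [tag: hilbert_symbol] [tag: ramification]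

Topic `NumberTheory/Automorphic`; THEOREMS ONLY (no definition, no named fact, no instance; net Literature debt `0`).
Lane `lit-hodgefound`, seat p12, gen 45 — second file on the definite quaternion order of discriminant `5` (after
`MaximalOrderDiscFiveLattice`: the maximal order `O₅ = ℤ⟨1, i, (1+i+j)/2, (−2+i+k)/4⟩` of Mathlib's `ℍ[ℚ,−2,−5]`).
Exactly as `MaximalOrderDiscThreeRamification` (`(−1,−3)_ℚ`, `N⁻ = 3`) and `HurwitzOrderRamification` (`(−1,−1)_ℚ`, `N⁻ = 2`),
the only input specific to `(−2,−5)_ℚ` is Serre's table of Hilbert symbols `(−2,−5)_p`: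

* §1 `localSign_two_neg_two_neg_five` (**`(−2,−5)₂ = 1`**: `−2 = 2·(−1)`, `(2,−5)₂ = χ₈(−5) = −1` and
  `(−1,−5)₂ = (−1)^{ε(−1)ε(−5)} = −1` — `B` is SPLIT at `2`), `localSign_five_neg_two_neg_five` (**`(−2,−5)₅ = (−2∕5) = −1`**),
  `localSign_neg_two_neg_five_of_not_dvd` (`= 1` for `p ∤ 10`), `localSign_neg_two_neg_five_eq_one_iff` (`= 1 ⟺ p ∤ 5`);
* §2 **`isSplitAt_iff_not_dvd_five`**, **`ramifiedPlaces_eq`** (`Ram_f B = {v | p_v ∣ 5}`: `disc B = 5`, so `B ≄ (−1,−1 ∣ ℚ)` —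
  Voight Ex. 5.9), `mem_ramifiedPlaces_iff_five_mem` (the `EichlerPackage` format `(5) ⊆ v`), `not_isSplitAt_of_dvd_five`,
  `isSplitAt_of_not_dvd_five`;
* §3 **`isTotallyDefinite`** (`−2X² − 5Y² = 1` has no real solution).

## Sources

* J. Voight, *Quaternion Algebras*, GTM 288 (2021), Exercise 5.9 («Show that `(−2,−3 ∣ ℚ) ≃ (−1,−1 ∣ ℚ)` but `(−2,−5 ∣ ℚ) ≄ (−1,−1 ∣ ℚ)`»),
  Exercise 17.10, Thm. 25.4.1 (`D = 5`). [cite: Voight2021, Exercise 5.9; Exercise 17.10; Thm. 25.4.1]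
* J.-P. Serre, *A Course in Arithmetic* (1973), Ch. III §1.2 Thm. 1 (the explicit Hilbert symbols over `ℚ_p` and `ℝ`).
  [cite: Serre1973, Ch. III §1.2 Thm. 1]
* M.-F. Vignéras, *Arithmétique des algèbres de quaternions*, LNM 800 (1980), Ch. II §1 Thm. 1.1, Ch. III §1 Exemple
  («`Ram{a,b} = {v, (a,b)_v = −1}`»), Ch. III §3. [cite: VignerasLNM800, Ch. II §1 Thm. 1.1; Ch. III §1 Exemple; Ch. III §3]

## Scope (honest)

Theorems only — no definition, no named fact, no instance. Everything is the tree's general theory specialised to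
`D = ℍ[ℚ,−2,−5]`; the Brandt setup `(1, 5)` (a structure VALUE) needs the class number and is left to the sequel.
-/

open Quaternion
open scoped Pointwise
open IsDedekindDomain NumberField
open Literature.NumberTheory.Automorphic.Brandt
open Literature.NumberTheory.QuadraticForms

namespace Literature.NumberTheory.Automorphic.MaxOrderDiscFive

/-! ## §1 The Hilbert symbols `(−2,−5)_p` -/

section Signs

/-- **`(−2,−5)₂ = 1`** (`−2 = 2·(−1)`: `(2,−5)₂ = χ₈(−5) = −1`, `(−1,−5)₂ = (−1)^{ε(−1)ε(−5)} = −1`) — `(−2,−5)_ℚ` is split at `2`.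
[cite: Serre1973, Ch. III §1.2 Thm. 1] -/
theorem localSign_two_neg_two_neg_five : localSign 2 (-2) (-5) = 1 := by
  rw [localSign, if_pos rfl, show (-2 : ℤ) = 2 * -1 by norm_num,
    localSignTwo_mul_left (by norm_num) (by norm_num) (by norm_num), localSignTwo_two_left (by norm_num),
    localSignTwo_of_odd (by norm_num) (by norm_num)]
  have h8 : ZMod.χ₈ ((-5 : ℤ) : ZMod 8) = -1 := by decide
  have he : epsSign (-1) (-5) = -1 := by
    unfold epsSign
    decide
  rw [h8, he]
  norm_num

/-- **`(−2,−5)₅ = (−2∕5) = (−1∕5)(2∕5) = 1·(−1) = −1`** (`−5 = 5¹·(−1)`, `−2` a `5`-adic unit). [cite: Serre1973, Ch. III §1.2 Thm. 1] -/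
theorem localSign_five_neg_two_neg_five : localSign 5 (-2) (-5) = -1 := by
  haveI : Fact (Nat.Prime 5) := ⟨Nat.prime_five⟩
  rw [localSign, if_neg (by norm_num), localSignOdd_def]
  have h5 := padicValInt_eq_of_eq_pow_mul (p := 5) (a := -5) (u := -1) (n := 1) (by norm_num) (by norm_num)
  rw [h5.1, h5.2, padicValInt_of_not_dvd (p := 5) (by norm_num), primeCompl_of_not_dvd (p := 5) (by norm_num)]
  have hm2 : legendreSym 5 (-2) = -1 := by
    rw [show (-2 : ℤ) = -1 * 2 by norm_num, legendreSym.mul, legendreSym.at_neg_one (p := 5) (by decide),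
      legendreSym.at_two (p := 5) (by decide)]
    decide
  simp [hm2]

/-- **`(−2,−5)_p = 1` for `p ∤ 10`** (both entries are `p`-adic units, `p` odd). [cite: Serre1973, Ch. III §1.2 Thm. 1] -/
theorem localSign_neg_two_neg_five_of_not_dvd {p : ℕ} (hp : p.Prime) (hp10 : ¬ p ∣ 10) : localSign p (-2) (-5) = 1 := by
  refine localSign_eq_one_of_not_dvd hp fun h => hp10 ?_
  have h' : (p : ℤ) ∣ 20 := by
    have e : (2 : ℤ) * -2 * -5 = 20 := by norm_num
    rwa [e] at h
  have h'' : p ∣ 20 := by exact_mod_cast h'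
  have h20 : (20 : ℕ) = 2 * 10 := by norm_num
  rw [h20] at h''
  rcases (Nat.Prime.dvd_mul hp).1 h'' with h2 | h10
  · exact dvd_trans h2 (by norm_num)
  · exact h10

/-- **`(−2,−5)_p = 1 ⟺ p ∤ 5`** (`p` prime): the only finite place where the symbol is `−1` is `p = 5`.
[cite: Serre1973, Ch. III §1.2 Thm. 1] [cite: VignerasLNM800, Ch. III §1 Exemple] -/
theorem localSign_neg_two_neg_five_eq_one_iff {p : ℕ} (hp : p.Prime) : localSign p (-2) (-5) = 1 ↔ ¬ p ∣ 5 := by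
  constructor
  · intro h hp5
    have := (Nat.prime_dvd_prime_iff_eq hp Nat.prime_five).1 hp5
    subst this
    rw [localSign_five_neg_two_neg_five] at h
    norm_num at h
  · intro hp5
    by_cases hp2 : p = 2
    · subst hp2
      exact localSign_two_neg_two_neg_five
    · refine localSign_neg_two_neg_five_of_not_dvd hp fun h10 => ?_
      have h10' : p ∣ 2 * 5 := h10
      rcases (Nat.Prime.dvd_mul hp).1 h10' with h2 | h5
      · exact hp2 ((Nat.prime_dvd_prime_iff_eq hp Nat.prime_two).1 h2)
      · exact hp5 h5

end Signs

/-! ## §2 `Ram_f (−2,−5)_ℚ = {5}` -/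

section Ramification

/-- **`B = (−2,−5)_ℚ` is split at the finite place `v` iff `p_v ∤ 5`** (`B_v ≅ M₂(ℚ_v) ⟺ (−2,−5)_v = 1`).
[cite: VignerasLNM800, Ch. II §1 Thm. 1.1 and Ch. III §1 Exemple] [cite: Serre1973, Ch. III §1.2 Thm. 1] -/
theorem isSplitAt_iff_not_dvd_five (v : HeightOneSpectrum (𝓞 ℚ)) :
    IsSplitAt ℍ[ℚ,-2,-5] v ↔ ¬ Rat.HeightOneSpectrum.natGenerator v ∣ 5 := by
  have h := isSplitAt_iff_hilbertSymbol_eq_one ℚ ℍ[ℚ,-2,-5] (a := (-2 : ℚ)) (b := (-5 : ℚ)) (by norm_num) (by norm_num)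
    AlgEquiv.refl v
  have hs := hilbertSymbol_rat_eq_localSign v (a := -2) (b := -5) (by norm_num) (by norm_num)
  have e2 : ((-2 : ℤ) : ℚ) = -2 := by norm_num
  have e5 : ((-5 : ℤ) : ℚ) = -5 := by norm_num
  rw [e2, e5] at hs
  rw [h, hs, ← localSign_neg_two_neg_five_eq_one_iff (Rat.HeightOneSpectrum.prime_natGenerator v)]

/-- **`Ram_f (−2,−5)_ℚ = {v | p_v ∣ 5}`: the discriminant of `(−2,−5)_ℚ` is `5`** — the ramification clause of the Brandt
setups `Brandt.XiSetup · 5` (Voight Thm. 25.4.1, `D = 5`; in particular `B ≄ (−1,−1 ∣ ℚ)`, Ex. 5.9).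
[cite: VignerasLNM800, Ch. III §1 Exemple] [cite: Voight2021, Exercise 5.9 and Thm. 25.4.1] -/
theorem ramifiedPlaces_eq :
    ramifiedPlaces ℚ ℍ[ℚ,-2,-5] = {v | ((Rat.HeightOneSpectrum.primesEquiv v : Nat.Primes) : ℕ) ∣ 5} := by
  ext v
  rw [mem_ramifiedPlaces_iff, isSplitAt_iff_not_dvd_five, not_not]
  rfl

/-- **`v ∈ Ram(B) ⟺ (5) ⊆ v`** — the ramification hypothesis in the `EichlerPackage` format. [cite: VignerasLNM800, Ch. III §1 Exemple] -/
theorem mem_ramifiedPlaces_iff_five_mem (v : HeightOneSpectrum (𝓞 ℚ)) :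
    v ∈ ramifiedPlaces ℚ ℍ[ℚ,-2,-5] ↔ ((5 : ℕ) : 𝓞 ℚ) ∈ v.asIdeal := by
  rw [ramifiedPlaces_eq, Set.mem_setOf_eq, primesEquiv_dvd_iff]

/-- `(−2,−5)_ℚ` is NOT split at the place over `5`. [cite: VignerasLNM800, Ch. III §1 Exemple] -/
theorem not_isSplitAt_of_dvd_five {v : HeightOneSpectrum (𝓞 ℚ)} (hv : Rat.HeightOneSpectrum.natGenerator v ∣ 5) :
    ¬ IsSplitAt ℍ[ℚ,-2,-5] v := by
  rw [isSplitAt_iff_not_dvd_five, not_not]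
  exact hv

/-- `(−2,−5)_ℚ` IS split at every place not over `5` (in particular at `2`). [cite: VignerasLNM800, Ch. III §1 Exemple] -/
theorem isSplitAt_of_not_dvd_five {v : HeightOneSpectrum (𝓞 ℚ)} (hv : ¬ Rat.HeightOneSpectrum.natGenerator v ∣ 5) :
    IsSplitAt ℍ[ℚ,-2,-5] v :=
  (isSplitAt_iff_not_dvd_five v).2 hv

end Ramification

/-! ## §3 `(−2,−5)_ℚ` is totally definite -/

section Definite

/-- **`(−2,−5)_ℚ` is totally definite**: it is ramified at the real place of `ℚ` — were `ℝ ⊗ B ≅ M₂(ℝ)`, the equation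
`−2X² − 5Y² = 1` would be solvable in `ℝ`. [cite: VignerasLNM800, Ch. III §3 (algèbre totalement définie)] [cite: Serre1973, Ch. III §1.2 Thm. 1 (`(−2,−5)_∞ = −1`)] -/
theorem isTotallyDefinite : IsTotallyDefinite ℚ ℍ[ℚ,-2,-5] := by
  intro w hw
  have hwr : w.IsReal := IsTotallyReal.isReal w
  obtain ⟨x, y, hxy⟩ := (isSplitAtInfinite_quaternionAlgebra_iff (K := ℚ) (a := (-2 : ℚ)) (b := (-5 : ℚ))
    (by norm_num) (by norm_num) w).1 hw
  rw [map_neg, map_ofNat, map_neg, map_ofNat] at hxy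
  have h2 := congr_arg (InfinitePlace.Completion.extensionEmbeddingOfIsReal hwr) hxy
  simp only [map_sub, map_mul, map_pow, map_neg, map_ofNat] at h2
  nlinarith [sq_nonneg (InfinitePlace.Completion.extensionEmbeddingOfIsReal hwr x),
    sq_nonneg (InfinitePlace.Completion.extensionEmbeddingOfIsReal hwr y)]

end Definite

end Literature.NumberTheory.Automorphic.MaxOrderDiscFive
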